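import Summits.QuantumFields.YangMills.Theorems.SqueezedSkewnessChiChain
import HarnessLib

/-!
# Route `SqueezedSkewness`, LINE χ: `FemtoFloorUnit` and `BalabanLadder.NT` from `FBL6` + the WEAK floor clause (consumption audit, kernel-exact)

Fleet lead `ym-spine-19353-p1` g20.  The engine item `FemtoTwoPointUnit` (stmt-QuantumFields-23679) asks for `FBL6 ∧ FC2` BY NAME at one
unit.  The χ-path consumer (`CollarBumpFloors` 23680, this seat) uses of `FC2` ONLY its lower half on x-centred femto cubes in the forward
cone together with the growth clause `Γ(s)/s⁸ → ∞` and the collar `s K(s) → 0` — the weak floor clause (F) of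
`Theorems/BalabanLadderNTWeakPackageTwoPoint.lean` (no upper bound, no continuity, no `Γ ≤ 1`).  This file re-runs the two χ₂ theorems with
(F) in place of `FC2` and records the consequence for the rung leaf:

* `twoPoint_floor_window_weak` — `FBL ∧ (F) ⇒` the windowed two-point floor (verbatim the proof of `twoPoint_floor_window`);
* `femtoFloorUnit_of_weak` — `(∀ G, ∃ (r, a), units ∧ FBL6 ∧ (F)) → FemtoFloorUnit` BY NAME (verbatim the proof of `collarBumpFloors_proof`);
* `nt_of_weakFemtoUnit_torusKL_shellSign` — `(∀ G, ∃ (r, a), units ∧ FBL6 ∧ (F)) → TorusKL → ShellSign → BalabanLadder.NT`.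

So on LINE χ the engine debt for clause (i) is `FBL6 ∧ (F)` (a candidate RETYPE of 23679; planner's call — nothing is re-filed here).
HONEST FRAMING: conditional compositions; `FBL6`, (F), `TorusKL`, `ShellSign`, NT NOT proved; YM mass gap NOT proved; not Clay.
(`maxHeartbeats 400000` on `femtoFloorUnit_of_weak` only: the route's reflection form is a large explicit term.) [folklore]
-/

set_option autoImplicit false

noncomputable section

open scoped SchwartzMap
open MeasureTheory Filter Topology Metric
open Literature.MathematicalPhysics.QuantumFieldTheory Literature.MathematicalPhysics.QuantumLattice
open Literature.MathematicalPhysics.AQFT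
open Literature.Probability.LatticeModels (box)
open Summit.QuantumFields.YangMills.Theorems.OSLegsFromFemtoAndGap.StubLower
open Summit.QuantumFields.YangMills.Cruxes.OSLegsFromFemtoAndGap.DlrCollarTransfer
open Summit.QuantumFields.YangMills.Cruxes.OSLegsFromFemtoAndGap.DlrCollarTransfer.StubLower
open Summit.QuantumFields.YangMills.Cruxes.NT.WeakPackage (pair_floor_weak)
open Summit.QuantumFields.YangMills.Theorems.ThermalDescentTorusDictionary (eF aF zOf sum_box_eq_sum_fin)
open Summit.QuantumFields.YangMills.Theorems.ThermalDescentCornerCov (posZ)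
open Summit.QuantumFields.YangMills.Theorems.ThermalDescentSeamFromMoments (posZ_eq_siteToE_zOf exists_abs_sub_le_decay)
open Summit.QuantumFields.YangMills.Theorems.FemtoCeilingProof (inv_bracket_add_le exists_abs_le_decay sum_abs_translate_le)
open Summit.QuantumFields.YangMills.Cruxes.NT.Reference (eventually_le_of_tendsto div_pow_depth_le)
open Summit.QuantumFields.YangMills.Theorems.CollarBumpCross (abs_cross_le)
open Summit.QuantumFields.YangMills.Theorems.CollarBumpTwoPoint (add_smul_single_sub tsupport_translate_subset)
open Summit.QuantumFields.YangMills.Theorems.CollarBumpFloorsProof (sum_abs_sub_translate_le le_of_split cross_arith mul_div_succ_le)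
open Summit.QuantumFields.YangMills.Theses.SqueezedSkewness

namespace Summit.QuantumFields.YangMills.Theorems.SqueezedSkewnessWeakFemtoUnit

section Window

variable (G : Type) [Group G] [TopologicalSpace G] [IsTopologicalGroup G] [CompactSpace G]
  [MeasurableSpace G] [BorelSpace G] (r : LatticeRep G) (a : ℝ → ℝ)

/-- **The two-point floor over the femto window from the WEAK floor clause.**  From `FBL G r a` and the weak floor clause (F) (units
`0 < a → 0`): for every `ρ > 0` there are a bump `v ≥ 0` supported in `closedBall(e₀, ρ)` and in a slab `{δ₁ < y₀ < δ₂}` (`δ₁ > 0`), a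
femto height `h₁ > 0` with `3h₁ ≤ δ₁`, and `ε > 0`, `β₅`, `Λ₅` such that every translate `f = v(· + τ e₀)` with lower edge
`δ₁ − τ ∈ [h₁, 3h₁]` has `3ε ≤ Q2 G r β L (a β) (θf) f` for `β ≥ β₅`, `a(β)L ≥ Λ₅` (the spine's `lowerBounds_twoPoint_weak` with radius and
height as parameters: femto scale `σ`, `h₁ = σ/12`, radius `ρ⋆ = min(ρ, σ/8)`, per-pair floor `pair_floor_weak` at the pair scale
`S = 2(1 − τ) ≤ σ`, plateau Riemann masses; same proof as `CollarBumpTwoPoint.twoPoint_floor_window`, which destructures `FC2` into (F) first). [folklore] -/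
theorem twoPoint_floor_window_weak (hapos : ∀ β, 0 < a β) (hlim : Tendsto a atTop (𝓝 0)) (hFBL : FBL G r a)
    (hF : (∃ (Γ : ℝ → ℝ) (β₂ ℓ₂ c₂ : ℝ) (K : ℝ → ℝ) (n₀ : ℕ), 0 < ℓ₂ ∧ 0 < c₂ ∧ (∀ s, 1 ≤ K s) ∧
      Tendsto (fun s : ℝ => s * K s) (nhdsWithin 0 (Set.Ioi 0)) (nhds 0) ∧ 1 ≤ n₀ ∧
      Tendsto (fun s : ℝ => Γ s / s ^ 8) (nhdsWithin 0 (Set.Ioi 0)) atTop ∧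
      ∀ β : ℝ, β₂ ≤ β → ∀ (x : Fin 4 → ℤ) (R : ℕ), ((2 * R + 1 : ℕ) : ℝ) * a β ≤ ℓ₂ →
        ∀ (η : LGConfig 4 G) (y : Fin 4 → ℤ) (s₀ : ℝ), 0 < s₀ → s₀ ≤ ‖siteToE (y - x)‖ * a β →
          (n₀ : ℝ) ≤ ‖siteToE (y - x)‖ → ‖siteToE (y - x)‖ < 3 * siteToE (y - x) 0 →
            K s₀ * ‖siteToE (y - x)‖ ≤ depth (fun j => x j - R) (2 * R + 1) y →
              c₂ * Γ (‖siteToE (y - x)‖ * a β) ≤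
                ‖siteToE (y - x)‖ ^ 8 * kerCov G r β (fun j => x j - R) (2 * R + 1) η (dens G r x) (dens G r y))) (ρ : ℝ) (hρ : 0 < ρ) :
    ∃ (v : 𝓢(EuclideanSpace ℝ (Fin 4), ℝ)), (∀ x, 0 ≤ v x) ∧
      tsupport (v : EuclideanSpace ℝ (Fin 4) → ℝ) ⊆ closedBall (EuclideanSpace.single (0 : Fin 4) (1 : ℝ)) ρ ∧
      ∃ (δ₁ δ₂ h₁ ε β₅ Λ₅ : ℝ), 0 < δ₁ ∧
        tsupport (v : EuclideanSpace ℝ (Fin 4) → ℝ) ⊆ {y : EuclideanSpace ℝ (Fin 4) | δ₁ < y 0 ∧ y 0 < δ₂} ∧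
        0 < h₁ ∧ 3 * h₁ ≤ δ₁ ∧ 0 < ε ∧
        ∀ β : ℝ, β₅ ≤ β → ∀ L : ℕ, Λ₅ ≤ a β * L → ∀ (τ : ℝ) (f : 𝓢(EuclideanSpace ℝ (Fin 4), ℝ)),
          h₁ ≤ δ₁ - τ → δ₁ - τ ≤ 3 * h₁ → (∀ y, f y = v (y + τ • EuclideanSpace.single (0 : Fin 4) (1 : ℝ))) →
            3 * ε ≤ Q2 G r β L (a β) (thetaTest 4 f) f := by
  obtain ⟨C₁, β₁, ℓ₁, p, hℓ₁, hC₁, hFBLc⟩ := hFBL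
  obtain ⟨Γ, β₂, ℓ₂, c₂, K, n₀, hℓ₂, hc₂, hK1, hKlim, hn₀, hΓlim, hFc⟩ := hF
  obtain ⟨ℓ, hℓ⟩ : ∃ ℓ : ℝ, ℓ = min ℓ₁ ℓ₂ := ⟨_, rfl⟩
  have hℓ0 : 0 < ℓ := by rw [hℓ]; exact lt_min hℓ₁ hℓ₂
  have hℓℓ₁ : ℓ ≤ ℓ₁ := hℓ ▸ min_le_left _ _
  have hℓℓ₂ : ℓ ≤ ℓ₂ := hℓ ▸ min_le_right _ _
  obtain ⟨D, hD⟩ : ∃ D : ℝ, D = ℓ / 100 := ⟨_, rfl⟩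
  have hD0 : 0 < D := by rw [hD]; positivity
  obtain ⟨M, hM⟩ : ∃ M : ℝ, M = 8 * C₁ ^ 2 / (c₂ * D ^ 8) + 1 := ⟨_, rfl⟩
  have hM0 : 0 < M := by rw [hM]; positivity
  have hMC : 4 * C₁ ^ 2 / D ^ 8 ≤ c₂ * M / 2 := by
    have : c₂ * M / 2 = 4 * C₁ ^ 2 / D ^ 8 + c₂ / 2 := by
      rw [hM]; field_simp; ring
    rw [this]; linarith
  obtain ⟨δK, hδK, hKδ⟩ := exists_delta_of_tendsto_mul hKlim (ε := ℓ / 100) (by positivity)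
  obtain ⟨δΓ, hδΓ, hΓδ⟩ := exists_delta_of_tendsto_div_atTop hΓlim M
  obtain ⟨σ, hσ⟩ : ∃ σ : ℝ, σ = min (min δK (δΓ / 2)) (min (ℓ / 100) 1) := ⟨_, rfl⟩
  have hσ0 : 0 < σ := by rw [hσ]; positivity
  have hσK : σ ≤ δK := by rw [hσ]; exact (min_le_left _ _).trans (min_le_left _ _)
  have hσΓ : σ ≤ δΓ / 2 := by rw [hσ]; exact (min_le_left _ _).trans (min_le_right _ _)
  have hσℓ : σ ≤ ℓ / 100 := by rw [hσ]; exact (min_le_right _ _).trans (min_le_left _ _)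
  have hσ1 : σ ≤ 1 := by rw [hσ]; exact (min_le_right _ _).trans (min_le_right _ _)
  obtain ⟨h₁, hh₁⟩ : ∃ h₁ : ℝ, h₁ = σ / 12 := ⟨_, rfl⟩
  have hh₁0 : 0 < h₁ := by rw [hh₁]; positivity
  obtain ⟨ρs, hρs⟩ : ∃ ρs : ℝ, ρs = min ρ (σ / 8) := ⟨_, rfl⟩
  have hρs0 : 0 < ρs := by rw [hρs]; exact lt_min hρ (by positivity)
  have hρsρ : ρs ≤ ρ := by rw [hρs]; exact min_le_left _ _
  have hρsσ : ρs ≤ σ / 8 := by rw [hρs]; exact min_le_right _ _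
  obtain ⟨v, hv0, -, hvone, hvsupp, hvts⟩ :=
    exists_bump_schwartz (EuclideanSpace.single (0 : Fin 4) (1 : ℝ)) (ρ := ρs / 2) (by positivity)
  have h2ρ : 2 * (ρs / 2) = ρs := by ring
  rw [h2ρ] at hvsupp hvts
  have hn₀0 : (0 : ℝ) < n₀ := by exact_mod_cast hn₀
  obtain ⟨β₀, hβ₀⟩ := exists_of_tendsto_atTop_nhds_zero hlim
    (a₀ := min (ℓ / 100) (min (h₁ / n₀) (ρs / 4))) (by positivity)
  refine ⟨v, hv0, ?_, 1 - 2 * ρs, 1 + 2 * ρs, h₁, c₂ * M / 2 * (ρs / 4) ^ 8 / 3, max β₀ (max β₁ β₂), max ℓ 2,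
    by linarith, ?_, hh₁0, by linarith, by positivity, ?_⟩
  · rw [hvts]; exact closedBall_subset_closedBall hρsρ
  · -- the slab
    rw [hvts]
    intro y hy
    rw [mem_closedBall, dist_eq_norm] at hy
    have h1 := abs_apply_le_norm (y - EuclideanSpace.single 0 (1 : ℝ)) 0
    have h2 : |y 0 - 1| ≤ ρs := by simpa using h1.trans hy
    constructor
    · show 1 - 2 * ρs < y 0
      have := (abs_le.1 h2).1; linarith
    · show y 0 < 1 + 2 * ρs
      have := (abs_le.1 h2).2; linarith
  intro β hβ L hL τ f hτ1 hτ2 hf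
  have hββ₀ : β₀ ≤ β := le_of_max_le_left hβ
  have hββ₁ : β₁ ≤ β := le_of_max_le_left (le_of_max_le_right hβ)
  have hββ₂ : β₂ ≤ β := le_of_max_le_right (le_of_max_le_right hβ)
  have hα := hapos β
  have hαa₀ := hβ₀ β hββ₀
  have hαℓ : a β ≤ ℓ / 100 := (hαa₀.trans_le (min_le_left _ _)).le
  have hαn : a β ≤ h₁ / n₀ := (hαa₀.trans_le ((min_le_right _ _).trans (min_le_left _ _))).le
  have hαρ : a β ≤ ρs / 4 := (hαa₀.trans_le ((min_le_right _ _).trans (min_le_right _ _))).le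
  have hLℓ : ℓ ≤ a β * L := (le_max_left _ _).trans hL
  have hL2 : 2 ≤ a β * L := (le_max_right _ _).trans hL
  obtain ⟨S, hS⟩ : ∃ S : ℝ, S = 2 * (1 - τ) := ⟨_, rfl⟩
  have hS2 : S / 2 = 1 - τ := by rw [hS]; ring
  have hSlo : 2 * h₁ + 4 * ρs ≤ S := by rw [hS]; linarith
  have hShi : S ≤ 6 * h₁ + 4 * ρs := by rw [hS]; linarith
  have hSσ : S ≤ σ := by
    have : 6 * h₁ + 4 * ρs ≤ σ := by rw [hh₁]; linarith
    linarith
  have hS0 : 0 < S := by linarith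
  have hSδΓ : 3 * S / 2 < δΓ := by linarith
  have hSℓ : S ≤ ℓ / 100 := hSσ.trans hσℓ
  have hSK : S * K (S / 2) < 2 * ℓ / 100 := by
    have := hKδ (S / 2) (by positivity) (by linarith)
    linarith
  have hαn₀ : (n₀ : ℝ) * a β ≤ S / 2 := by
    rw [le_div_iff₀ (by positivity)] at hαn; linarith
  obtain ⟨hfem₁, hfem₂, hL'⟩ := femto_budget (L := L) hℓℓ₁ hℓℓ₂ hSℓ hS0 hSK hαℓ hLℓ
  rw [← hD] at hfem₁ hfem₂ hL'
  have hfz : ∀ z : EuclideanSpace ℝ (Fin 4), f z ≠ 0 → ‖z - EuclideanSpace.single 0 (S / 2)‖ < ρs := by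
    intro z hz
    rw [hf z] at hz
    have h := hvsupp _ hz
    rwa [dist_eq_norm, add_smul_single_sub, ← hS2] at h
  have hf1 : ∀ z : EuclideanSpace ℝ (Fin 4), dist z (EuclideanSpace.single 0 (S / 2)) ≤ ρs / 2 → f z = 1 := by
    intro z hz
    rw [hf z]
    refine hvone _ ?_
    rwa [dist_eq_norm, add_smul_single_sub, ← hS2, ← dist_eq_norm]
  have hf0 : ∀ z : EuclideanSpace ℝ (Fin 4), 0 ≤ f z := fun z => by rw [hf z]; exact hv0 _
  have hρS : ρs < S / 4 := by linarith
  have key : ∀ x y : Fin 4 → ℤ, thetaTest 4 f (a β • siteToE x) ≠ 0 → f (a β • siteToE y) ≠ 0 →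
      c₂ * M / 2 * a β ^ 8 ≤ torusE G r β L (fun U => dens G r x U * dens G r y U)
        - torusE G r β L (dens G r x) * torusE G r β L (dens G r y) := by
    intro x y hx hy
    refine pair_floor_weak G r a hC₁ hFBLc hc₂ hK1 hFc hS0 hD0 hΓδ hSδΓ hMC hββ₁ hββ₂ hα hαn₀
      hfem₁ hfem₂ hL' x y ?_ ?_
    · rw [thetaTest_apply] at hx
      have := hfz _ hx
      rw [norm_timeReflection_sub_single] at this
      linarith
    · have := hfz _ hy
      linarith
  have hS21 : S / 2 ≤ 1 := by linarith
  have hcover : ∀ j, |(EuclideanSpace.single (0 : Fin 4) (S / 2) : EuclideanSpace ℝ (Fin 4)) j|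
      + ρs / 2 ≤ a β * L := fun j => by
    have : |(EuclideanSpace.single (0 : Fin 4) (S / 2) : EuclideanSpace ℝ (Fin 4)) j| ≤ S / 2 := by
      rw [PiLp.single_apply]
      split_ifs
      · rw [abs_of_pos (by positivity)]
      · rw [abs_zero]; positivity
    linarith
  have hρa : 2 * a β ≤ ρs / 2 := by linarith
  have hSy : (ρs / 2 / (2 * a β)) ^ 4 ≤ ∑ y ∈ box 4 L, f (a β • siteToE y) :=
    pow_le_sum_box hf0 hα (fun z hz => hf1 z hz) hρa hcover
  have hSx : (ρs / 2 / (2 * a β)) ^ 4 ≤ ∑ x ∈ box 4 L, thetaTest 4 f (a β • siteToE x) := by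
    refine pow_le_sum_box (p := -EuclideanSpace.single 0 (S / 2)) (fun z => ?_) hα
      (fun z hz => ?_) hρa (fun j => by simpa using hcover j)
    · rw [thetaTest_apply]; exact hf0 _
    · rw [thetaTest_apply]
      refine hf1 _ ?_
      rwa [dist_eq_norm, norm_timeReflection_sub_single, ← sub_neg_eq_add, ← dist_eq_norm]
  have hsum := mul_sum_mul_sum_le (B := box 4 L) (κ := c₂ * M / 2 * a β ^ 8)
    (f := fun x => thetaTest 4 f (a β • siteToE x)) (g := fun y => f (a β • siteToE y))
    (C := fun x y => torusE G r β L (fun U => dens G r x U * dens G r y U)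
      - torusE G r β L (dens G r x) * torusE G r β L (dens G r y))
    (fun x => by rw [thetaTest_apply]; exact hf0 _) (fun y => hf0 _) key
  unfold Q2
  refine le_trans ?_ hsum
  have hα0 : a β ≠ 0 := hα.ne'
  calc 3 * (c₂ * M / 2 * (ρs / 4) ^ 8 / 3)
      = c₂ * M / 2 * a β ^ 8 * ((ρs / 2 / (2 * a β)) ^ 4 * (ρs / 2 / (2 * a β)) ^ 4) := by
        field_simp; ring
    _ ≤ _ := mul_le_mul_of_nonneg_left (mul_le_mul hSx hSy (by positivity)
        ((by positivity : (0 : ℝ) ≤ (ρs / 2 / (2 * a β)) ^ 4).trans hSx)) (by positivity)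

end Window

/-! ## §2 `FemtoFloorUnit` from `FBL6` + (F) -/

set_option maxHeartbeats 400000 in
/-- **`FemtoFloorUnit` BY NAME from a unit carrying `FBL6` and the weak floor clause (F)** (verbatim the proof of
`CollarBumpFloorsProof.collarBumpFloors_proof` with `twoPoint_floor_window_weak`). [folklore] -/
theorem femtoFloorUnit_of_weak
    (h : ∀ (G : Type) [Group G] [TopologicalSpace G] [IsTopologicalGroup G] [CompactSpace G],
      IsCompactSimpleLieGroup G → letI : MeasurableSpace G := borel G; haveI : BorelSpace G := ⟨rfl⟩;
      ∃ (r : LatticeRep G) (a : ℝ → ℝ), (∀ β, 0 < a β) ∧ Tendsto a atTop (𝓝 0) ∧ FBL6 G r a ∧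
      (∃ (Γ : ℝ → ℝ) (β₂ ℓ₂ c₂ : ℝ) (K : ℝ → ℝ) (n₀ : ℕ), 0 < ℓ₂ ∧ 0 < c₂ ∧ (∀ s, 1 ≤ K s) ∧
      Tendsto (fun s : ℝ => s * K s) (nhdsWithin 0 (Set.Ioi 0)) (nhds 0) ∧ 1 ≤ n₀ ∧
      Tendsto (fun s : ℝ => Γ s / s ^ 8) (nhdsWithin 0 (Set.Ioi 0)) atTop ∧
      ∀ β : ℝ, β₂ ≤ β → ∀ (x : Fin 4 → ℤ) (R : ℕ), ((2 * R + 1 : ℕ) : ℝ) * a β ≤ ℓ₂ →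
        ∀ (η : LGConfig 4 G) (y : Fin 4 → ℤ) (s₀ : ℝ), 0 < s₀ → s₀ ≤ ‖siteToE (y - x)‖ * a β →
          (n₀ : ℝ) ≤ ‖siteToE (y - x)‖ → ‖siteToE (y - x)‖ < 3 * siteToE (y - x) 0 →
            K s₀ * ‖siteToE (y - x)‖ ≤ depth (fun j => x j - R) (2 * R + 1) y →
              c₂ * Γ (‖siteToE (y - x)‖ * a β) ≤
                ‖siteToE (y - x)‖ ^ 8 * kerCov G r β (fun j => x j - R) (2 * R + 1) η (dens G r x) (dens G r y))) :
    FemtoFloorUnit := by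
  intro G _ _ _ _ hG
  letI : MeasurableSpace G := borel G
  haveI : BorelSpace G := ⟨rfl⟩
  haveI : SecondCountableTopology G := by
    obtain ⟨r, -⟩ := h G hG
    exact (r.continuous.isClosedEmbedding r.injective).isEmbedding.secondCountableTopology
  obtain ⟨r, a, ha, ha0, hFBL6, hF⟩ := h G hG
  refine ⟨r, a, ?_⟩
  dsimp only
  refine ⟨ha, ha0, hFBL6, ?_⟩
  intro ρ hρ
  obtain ⟨v, hv0, hvball, δ₁, δ₂, h₁, ε, β₅, Λ₅, hδ₁, hvslab, hh₁, h3h₁, hε, hfloor⟩ :=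
    twoPoint_floor_window_weak G r a ha ha0 (fbl_of_fbl6 r a hFBL6) hF ρ hρ
  obtain ⟨C, β₄, ℓ₄, hℓ₄, hC0, hMB⟩ :=
    Summit.QuantumFields.YangMills.Cruxes.OSLegsFromFemtoAndGap.DlrCollarTransfer.stub_collar6 G r a hFBL6
  obtain ⟨K₀, hK₀0, hK₀⟩ := exists_abs_le_decay v
  obtain ⟨K₁, hK₁0, hK₁⟩ := exists_abs_sub_le_decay v
  obtain ⟨c₀, hc₀⟩ : ∃ c₀ : ℝ, c₀ = min (h₁ / 4) ℓ₄ := ⟨_, rfl⟩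
  have hc₀0 : 0 < c₀ := by rw [hc₀]; exact lt_min (by positivity) hℓ₄
  have hc₀h : c₀ ≤ h₁ / 4 := by rw [hc₀]; exact min_le_left _ _
  have hc₀ℓ : c₀ ≤ ℓ₄ := by rw [hc₀]; exact min_le_right _ _
  obtain ⟨T₀, hT₀⟩ : ∃ T₀ : ℝ, T₀ = |δ₁| + 3 * h₁ := ⟨_, rfl⟩
  have hT₀0 : 0 ≤ T₀ := by rw [hT₀]; positivity
  obtain ⟨Mx, hMx⟩ : ∃ Mx : ℝ, Mx = 18 * C ^ 2 * (2 / c₀) ^ 8 * K₁ * K₀ * 4 ^ 8 * ((1 + T₀) ^ 8) ^ 2 := ⟨_, rfl⟩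
  have hMx0 : 0 ≤ Mx := by rw [hMx]; positivity
  obtain ⟨βa, hβa⟩ := eventually_le_of_tendsto ha0 (δ := min (min (c₀ / 2) (h₁ / 4)) (min 1 (ε / (Mx + 1))))
    (lt_min (lt_min (by positivity) (by positivity)) (lt_min one_pos (by positivity)))
  refine ⟨v, hv0, hvball, δ₁, δ₂, h₁, ε, max (max β₅ β₄) (max βa 0),
    max Λ₅ (max (4 * c₀ + 8) (2 * (|δ₂| + T₀) + 1)), hδ₁, hvslab, hh₁, h3h₁, hε, ?_⟩
  intro β hβ L hL τ f hτ1 hτ2 hf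
  have hβ₅ : β₅ ≤ β := le_trans (le_max_left _ _) (le_trans (le_max_left _ _) hβ)
  have hβ₄ : β₄ ≤ β := le_trans (le_max_right _ _) (le_trans (le_max_left _ _) hβ)
  have hβa' : βa ≤ β := le_trans (le_max_left _ _) (le_trans (le_max_right _ _) hβ)
  have hβ0 : 0 ≤ β := le_trans (le_max_right _ _) (le_trans (le_max_right _ _) hβ)
  have hs : 0 < a β := ha β
  have hsa := hβa β hβa'
  have hsc : a β ≤ c₀ / 2 := hsa.trans ((min_le_left _ _).trans (min_le_left _ _))
  have hsh : a β ≤ h₁ / 4 := hsa.trans ((min_le_left _ _).trans (min_le_right _ _))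
  have hs1 : a β ≤ 1 := hsa.trans ((min_le_right _ _).trans (min_le_left _ _))
  have hsε : a β ≤ ε / (Mx + 1) := hsa.trans ((min_le_right _ _).trans (min_le_right _ _))
  have hLΛ : Λ₅ ≤ a β * L := (le_max_left _ _).trans hL
  have hLc : 4 * c₀ + 8 ≤ a β * L := (le_max_left _ _).trans ((le_max_right _ _).trans hL)
  have hLδ : 2 * (|δ₂| + T₀) + 1 ≤ a β * L := (le_max_right _ _).trans ((le_max_right _ _).trans hL)
  have hL1 : 1 ≤ L := by
    rcases Nat.eq_zero_or_pos L with h | h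
    · exfalso
      rw [h, Nat.cast_zero, mul_zero] at hLc
      linarith
    · exact h
  have hτabs : |τ| ≤ T₀ := by
    rw [hT₀, abs_le]
    constructor
    · linarith [le_abs_self δ₁]
    · linarith [le_abs_self δ₁]
  have hw : ‖τ • EuclideanSpace.single (0 : Fin 4) (1 : ℝ)‖ ≤ T₀ := by
    rw [norm_smul, PiLp.norm_single, norm_one, mul_one, Real.norm_eq_abs]; exact hτabs
  have hδ₁τ : 0 < δ₁ - τ := by linarith
  have hfslab : tsupport (f : EuclideanSpace ℝ (Fin 4) → ℝ) ⊆
      {y : EuclideanSpace ℝ (Fin 4) | δ₁ - τ < y 0 ∧ y 0 < δ₂ - τ} := by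
    intro y hy
    have h := hvslab (tsupport_translate_subset hf hy)
    simp only [Set.mem_setOf_eq, PiLp.add_apply, PiLp.smul_apply, PiLp.single_apply, if_true, smul_eq_mul,
      mul_one] at h
    constructor <;> linarith [h.1, h.2]
  have hδ₂' : |δ₂ - τ| ≤ |δ₂| + T₀ := (abs_sub _ _).trans (by linarith)
  have hLsep : 2 * |δ₂ - τ| + 1 ≤ a β * L := by linarith
  have hLTI : δ₂ - τ + a β ≤ a β * L := by linarith [le_abs_self (δ₂ - τ)]
  obtain ⟨R, hRdef⟩ : ∃ R : ℕ, R = ⌊c₀ / a β⌋₊ := ⟨_, rfl⟩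
  have hRle : (R : ℝ) ≤ c₀ / a β := by rw [hRdef]; exact Nat.floor_le (by positivity)
  have hRlt : c₀ / a β < R + 1 := by rw [hRdef]; exact Nat.lt_floor_add_one _
  have hc2 : 2 ≤ c₀ / a β := by rw [le_div_iff₀ hs]; linarith
  have hR1 : 1 ≤ R := by exact_mod_cast (show (1 : ℝ) ≤ R by linarith)
  have hRc : (R : ℝ) * a β ≤ c₀ := by rwa [le_div_iff₀ hs] at hRle
  have hRs : (R : ℝ) * a β ≤ ℓ₄ := hRc.trans hc₀ℓ
  have hRL : 4 * R + 8 ≤ L := by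
    have h1 : ((4 * R + 8 : ℕ) : ℝ) * a β ≤ (L : ℝ) * a β := by
      push_cast
      have : 4 * ((R : ℝ) * a β) + 8 * a β ≤ a β * L := by linarith
      linarith
    exact_mod_cast le_of_mul_le_mul_right h1 hs
  have hRsep : (2 * R + 4 : ℝ) ≤ 2 * (δ₁ - τ - a β) / a β := by
    rw [le_div_iff₀ hs]
    have h4 : 4 * a β ≤ δ₁ - τ := by linarith
    have h5 : 2 * ((R : ℝ) * a β) ≤ 2 * c₀ := by linarith
    nlinarith
  have hRhalf : c₀ / 2 / a β ≤ R := by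
    rw [div_div, show c₀ / (2 * a β) = c₀ / a β / 2 by rw [div_div, mul_comm]]; linarith
  have H : ∀ (n : ℕ) (q : Fin n → Fin 4 × Fin 4) (x : Fin n → (Fin 4 → ℤ)), (∀ i, (q i).1 < (q i).2) →
      (∀ i j : Fin n, i ≠ j → ∃ k : Fin 4,
        (2 * (R : ℤ) + 4) ≤ |((((x i k - x j k : ℤ) : ZMod (2 * L + 1))).valMinAbs : ℤ)|) →
      |torusE G r β L (fun U => ∏ i, (plane G r (q i) (x i) U - torusE G r β L (plane G r (q i) (x i))))| ≤
        (C / (R : ℝ) ^ 4) ^ n :=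
    fun n q x hq hsep => hMB β hβ₄ L n q x R hq hR1 hRs hRL hsep
  obtain ⟨W, hW⟩ : ∃ W : ℝ, W = (1 + ‖τ • EuclideanSpace.single (0 : Fin 4) (1 : ℝ)‖) ^ 8 := ⟨_, rfl⟩
  have hW0 : 0 ≤ W := by rw [hW]; positivity
  have hWT : W ≤ (1 + T₀) ^ 8 := by rw [hW]; exact pow_le_pow_left₀ (by positivity) (by linarith) 8
  have hCR : C / (R : ℝ) ^ 4 ≤ C * (a β / (c₀ / 2)) ^ 4 := div_pow_depth_le hC0 (by positivity) hs hRhalf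
  have hsmall : 18 * (C / (R : ℝ) ^ 4) ^ 2 * (K₁ * W * 4 ^ 4 / a β ^ 3) * (K₀ * W * 4 ^ 4 / a β ^ 4) ≤ ε := by
    have h1 : (C / (R : ℝ) ^ 4) ^ 2 ≤ (C * (a β / (c₀ / 2)) ^ 4) ^ 2 := pow_le_pow_left₀ (by positivity) hCR 2
    have h2 : 18 * (C * (a β / (c₀ / 2)) ^ 4) ^ 2 * (K₁ * W * 4 ^ 4 / a β ^ 3) * (K₀ * W * 4 ^ 4 / a β ^ 4) =
        (18 * C ^ 2 * (2 / c₀) ^ 8 * K₁ * K₀ * 4 ^ 8 * W ^ 2) * a β := cross_arith hs hc₀0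
    have h3 : 18 * C ^ 2 * (2 / c₀) ^ 8 * K₁ * K₀ * 4 ^ 8 * W ^ 2 ≤ Mx := by
      rw [hMx]
      have : W ^ 2 ≤ ((1 + T₀) ^ 8) ^ 2 := pow_le_pow_left₀ hW0 hWT 2
      exact mul_le_mul_of_nonneg_left this (by positivity)
    have h4 : Mx * (ε / (Mx + 1)) ≤ ε := mul_div_succ_le hMx0 hε
    have hB1 : 0 ≤ K₁ * W * 4 ^ 4 / a β ^ 3 := by positivity
    have hB2 : 0 ≤ K₀ * W * 4 ^ 4 / a β ^ 4 := by positivity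
    calc 18 * (C / (R : ℝ) ^ 4) ^ 2 * (K₁ * W * 4 ^ 4 / a β ^ 3) * (K₀ * W * 4 ^ 4 / a β ^ 4)
        ≤ 18 * (C * (a β / (c₀ / 2)) ^ 4) ^ 2 * (K₁ * W * 4 ^ 4 / a β ^ 3) * (K₀ * W * 4 ^ 4 / a β ^ 4) :=
          mul_le_mul_of_nonneg_right (mul_le_mul_of_nonneg_right
            (mul_le_mul_of_nonneg_left h1 (by norm_num)) hB1) hB2
      _ = (18 * C ^ 2 * (2 / c₀) ^ 8 * K₁ * K₀ * 4 ^ 8 * W ^ 2) * a β := h2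
      _ ≤ Mx * a β := mul_le_mul_of_nonneg_right h3 hs.le
      _ ≤ Mx * (ε / (Mx + 1)) := mul_le_mul_of_nonneg_left hsε hMx0
      _ ≤ ε := h4
  have hSd : ∑ x : FinTorusSite (2 * L + 1) (2 * L + 1) (2 * L + 1) (2 * L + 1),
      |f (a β • posZ (2 * L + 1) x + a β • EuclideanSpace.single (0 : Fin 4) (1 : ℝ)) - f (a β • posZ (2 * L + 1) x)| ≤
      K₁ * W * 4 ^ 4 / a β ^ 3 := by
    have e : ∀ x : FinTorusSite (2 * L + 1) (2 * L + 1) (2 * L + 1) (2 * L + 1),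
        |f (a β • posZ (2 * L + 1) x + a β • EuclideanSpace.single (0 : Fin 4) (1 : ℝ)) - f (a β • posZ (2 * L + 1) x)| =
        |v (a β • posZ (2 * L + 1) x + a β • EuclideanSpace.single (0 : Fin 4) (1 : ℝ) +
            τ • EuclideanSpace.single (0 : Fin 4) (1 : ℝ)) -
          v (a β • posZ (2 * L + 1) x + τ • EuclideanSpace.single (0 : Fin 4) (1 : ℝ))| := fun x => by
      rw [hf, hf]
    rw [Finset.sum_congr rfl (fun x _ => e x), hW]
    exact sum_abs_sub_translate_le hK₁0 hK₁ L hs hs1 _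
  have hSc : ∑ y : FinTorusSite (2 * L + 1) (2 * L + 1) (2 * L + 1) (2 * L + 1), |f (a β • posZ (2 * L + 1) y)| ≤
      K₀ * W * 4 ^ 4 / a β ^ 4 := by
    have e : ∀ y : FinTorusSite (2 * L + 1) (2 * L + 1) (2 * L + 1) (2 * L + 1),
        |f (a β • posZ (2 * L + 1) y)| =
        |v (a β • siteToE (zOf (2 * L + 1) y) + τ • EuclideanSpace.single (0 : Fin 4) (1 : ℝ))| := fun y => by
      rw [hf, posZ_eq_siteToE_zOf]
    rw [Finset.sum_congr rfl (fun y _ => e y), hW]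
    exact sum_abs_translate_le hK₀0 hK₀ L hs hs1 _
  have hQ2 : 3 * ε ≤ Q2 G r β L (a β) (thetaTest 4 f) f := hfloor β hβ₅ L hLΛ τ f hτ1 hτ2 hf
  have hcross := abs_cross_le G r β L H hs hs1 f hfslab hLsep hRsep hSd hSc
  have hTI := Summit.QuantumFields.YangMills.Theorems.ThermalDescentTransportIdentity.thermalDescent_transportIdentity G hG r
  dsimp only at hTI
  exact le_of_split (hTI β L (a β) f (δ₁ - τ) (δ₂ - τ) hβ0 hL1 hs hδ₁τ hfslab hLTI) hQ2 (hcross.trans hsmall)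


/-! ## §3 The χ-chain from the weak femto unit -/

/-- **`BalabanLadder.NT` from `FBL6` + (F) at one unit, `TorusKL` and `ShellSign`** (node B of LINE χ₃ + the route's `closes`).
[folklore] -/
theorem nt_of_weakFemtoUnit_torusKL_shellSign
    (h : ∀ (G : Type) [Group G] [TopologicalSpace G] [IsTopologicalGroup G] [CompactSpace G],
      IsCompactSimpleLieGroup G → letI : MeasurableSpace G := borel G; haveI : BorelSpace G := ⟨rfl⟩;
      ∃ (r : LatticeRep G) (a : ℝ → ℝ), (∀ β, 0 < a β) ∧ Tendsto a atTop (𝓝 0) ∧ FBL6 G r a ∧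
      (∃ (Γ : ℝ → ℝ) (β₂ ℓ₂ c₂ : ℝ) (K : ℝ → ℝ) (n₀ : ℕ), 0 < ℓ₂ ∧ 0 < c₂ ∧ (∀ s, 1 ≤ K s) ∧
      Tendsto (fun s : ℝ => s * K s) (nhdsWithin 0 (Set.Ioi 0)) (nhds 0) ∧ 1 ≤ n₀ ∧
      Tendsto (fun s : ℝ => Γ s / s ^ 8) (nhdsWithin 0 (Set.Ioi 0)) atTop ∧
      ∀ β : ℝ, β₂ ≤ β → ∀ (x : Fin 4 → ℤ) (R : ℕ), ((2 * R + 1 : ℕ) : ℝ) * a β ≤ ℓ₂ →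
        ∀ (η : LGConfig 4 G) (y : Fin 4 → ℤ) (s₀ : ℝ), 0 < s₀ → s₀ ≤ ‖siteToE (y - x)‖ * a β →
          (n₀ : ℝ) ≤ ‖siteToE (y - x)‖ → ‖siteToE (y - x)‖ < 3 * siteToE (y - x) 0 →
            K s₀ * ‖siteToE (y - x)‖ ≤ depth (fun j => x j - R) (2 * R + 1) y →
              c₂ * Γ (‖siteToE (y - x)‖ * a β) ≤
                ‖siteToE (y - x)‖ ^ 8 * kerCov G r β (fun j => x j - R) (2 * R + 1) η (dens G r x) (dens G r y)))
    (hKL : TorusKL) (hSign : ShellSign) : Summit.QuantumFields.YangMills.Theses.BalabanLadder.NT :=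
  closes (Summit.QuantumFields.YangMills.Theorems.SqueezedSkewnessChiChain.pointlikeHypercubeFloorsB_of_femto
      (femtoFloorUnit_of_weak h) hKL)
    Summit.QuantumFields.YangMills.Theorems.squeezedSkewness_seamFromMoments_proof
    Summit.QuantumFields.YangMills.Theorems.squeezedSkewness_hypercubeSeam
    Summit.QuantumFields.YangMills.Theorems.squeezedSkewness_shellGeometry hSign

end Summit.QuantumFields.YangMills.Theorems.SqueezedSkewnessWeakFemtoUnit

end
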